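import Mathlib
import Summits.KontsevichZagierPeriods.Zeta5Search.UniversalDigitW
import Summits.KontsevichZagierPeriods.Zeta5Search.SecondOrderDigit
import HarnessLib

/-!
# ζ(5) search — the class invariant `φ_x` and the unit `ĝ` TO SECOND ORDER (gen-2 g10, REPORT-gen2-g10 §1 (L2))

Cell `pub-zeta5` (HONEST FRAMING: systematic search; no irrationality claim unless certified), typer seat generation 11.
Part 2 of the Lean proof of gen-2 g10's CLASSWISE SECOND-DIGIT LEMMA.  For a residue class with base `x < p` and a class point
`q = x + ℓp` (window `b₀ < p²`, so every foreign difference `s − q` is a `p`-adic unit):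

* `padicNorm_phiHat_le_one` — `φ_q = phiHat b p q = Σ_{s ∉ class} netExp(s)/(s − q) (+ 1/(b₀/2 − q))` is `p`-integral;
* `padicNorm_phiHat_sub_le` — `φ_q ≡ φ_x (mod p)` (CLASS-CONSTANT modulo `p`);
* `padicNorm_gHat_sub_second_le` — **`ĝ_q ≡ ĝ_x (1 − ℓ p φ_x) (mod p²)`**: the refinement of G1 (`gHat_classCongr`, `ĝ_q ≡ ĝ_x (mod p)`)
  by one digit, from the factorwise expansion `(u − ℓp)^e ≡ u^e (1 − e ℓ p/u) (mod p²)` (`padicNorm_zpow_add_sub_le`) and its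
  product form (`padicNorm_prod_zpow_add_sub_le`, the logarithmic derivative modulo `p²`).

`p`-adic norms of rational numbers; nothing here concerns irrationality.
-/

noncomputable section

open Finset

namespace Summit.KontsevichZagierPeriods.Zeta5Search.SecondOrder

open Summit.KontsevichZagierPeriods.Zeta5Search.DualSeries (InBox)
open Summit.KontsevichZagierPeriods.Zeta5Search.CasoratianValuation (InPolytope)
open Summit.KontsevichZagierPeriods.Zeta5Search.ClusterValuation
open Summit.KontsevichZagierPeriods.Zeta5Search.PadicSeries
open Summit.KontsevichZagierPeriods.Zeta5Search.CellA (padicNorm_sub_eq_one_of_mod_ne padicNorm_zpow_unit padicNorm_pow_eq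
  padicNorm_inv' padicNorm_prod_le_one padicNorm_p)

variable {p : ℕ} [hp : Fact p.Prime]

/-! ### Small `p`-adic tools -/

/-- `‖1 + a‖ = 1` when `‖a‖ ≤ p⁻¹`. -/
theorem padicNorm_one_add_eq_one {a : ℚ} (ha : padicNorm p a ≤ (p : ℚ) ^ (-(1 : ℤ))) : padicNorm p (1 + a) = 1 := by
  have hlt : padicNorm p a < 1 := ha.trans_lt (zpow_lt_one_of_neg₀ one_lt_p (by norm_num))
  have hne : padicNorm p (1 : ℚ) ≠ padicNorm p a := by rw [padicNorm.one]; exact hlt.ne'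
  rw [padicNorm.add_eq_max_of_ne hne, padicNorm.one, max_eq_left hlt.le]

/-- Inverses of units congruent modulo `p²` are congruent modulo `p²`. -/
theorem padicNorm_inv_sub_inv_le_two {u v : ℚ} (hu : padicNorm p u = 1) (hv : padicNorm p v = 1)
    (huv : padicNorm p (u - v) ≤ (p : ℚ) ^ (-(2 : ℤ))) :
    padicNorm p (u⁻¹ - v⁻¹) ≤ (p : ℚ) ^ (-(2 : ℤ)) := by
  have hu0 : u ≠ 0 := fun h => by rw [h, padicNorm.zero] at hu; exact zero_ne_one hu
  have hv0 : v ≠ 0 := fun h => by rw [h, padicNorm.zero] at hv; exact zero_ne_one hv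
  have e : u⁻¹ - v⁻¹ = (v - u) / (u * v) := by field_simp
  rw [e, padicNorm.div, padicNorm.mul, hu, hv, mul_one, div_one, ← padicNorm.neg, neg_sub]
  exact huv

/-- `(1 + a)⁻¹ ≡ 1 − a (mod p²)` for `‖a‖ ≤ p⁻¹`. -/
theorem padicNorm_inv_one_add_sub_le {a : ℚ} (ha : padicNorm p a ≤ (p : ℚ) ^ (-(1 : ℤ))) :
    padicNorm p ((1 + a)⁻¹ - (1 - a)) ≤ (p : ℚ) ^ (-(2 : ℤ)) := by
  have h1 := padicNorm_one_add_eq_one ha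
  have h0 : (1 + a) ≠ 0 := fun h => by rw [h, padicNorm.zero] at h1; exact zero_ne_one h1
  have e : (1 + a)⁻¹ - (1 - a) = a ^ 2 / (1 + a) := by field_simp; ring
  rw [e, padicNorm.div, h1, div_one, padicNorm_pow_eq]
  calc padicNorm p a ^ 2 ≤ ((p : ℚ) ^ (-(1 : ℤ))) ^ 2 := pow_le_pow_left₀ (padicNorm.nonneg _) ha 2
    _ = (p : ℚ) ^ (-(2 : ℤ)) := by rw [← zpow_natCast, ← zpow_mul]; norm_num

/-! ### One factor: `(u + t)^e ≡ u^e (1 + e t/u) (mod p²)` -/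

/-- Natural powers: `(u + t)^m ≡ u^m (1 + m t/u) (mod p²)` for a unit `u` and `‖t‖ ≤ p⁻¹`. -/
theorem padicNorm_pow_add_sub_le {u t : ℚ} (hu : padicNorm p u = 1) (ht : padicNorm p t ≤ (p : ℚ) ^ (-(1 : ℤ))) (m : ℕ) :
    padicNorm p ((u + t) ^ m - u ^ m * (1 + (m : ℚ) * t / u)) ≤ (p : ℚ) ^ (-(2 : ℤ)) := by
  have hu0 : u ≠ 0 := fun h => by rw [h, padicNorm.zero] at hu; exact zero_ne_one hu
  have hut : padicNorm p (u + t) ≤ 1 :=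
    (padicNorm.nonarchimedean (p := p)).trans (max_le hu.le (ht.trans (zpow_le_one_of_nonpos₀ one_le_p (by norm_num))))
  have ht2 : padicNorm p (t ^ 2) ≤ (p : ℚ) ^ (-(2 : ℤ)) := by
    rw [padicNorm_pow_eq]
    calc padicNorm p t ^ 2 ≤ ((p : ℚ) ^ (-(1 : ℤ))) ^ 2 := pow_le_pow_left₀ (padicNorm.nonneg _) ht 2
      _ = (p : ℚ) ^ (-(2 : ℤ)) := by rw [← zpow_natCast, ← zpow_mul]; norm_num
  induction m with
  | zero => simp only [pow_zero, Nat.cast_zero, zero_mul, zero_div, add_zero, mul_one, sub_self, padicNorm.zero]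
            exact zpow_p_nonneg _
  | succ m ih =>
    have e : (u + t) ^ (m + 1) - u ^ (m + 1) * (1 + ((m + 1 : ℕ) : ℚ) * t / u) =
        (u + t) * ((u + t) ^ m - u ^ m * (1 + (m : ℚ) * t / u)) + (m : ℚ) * u ^ m / u * t ^ 2 := by
      push_cast; field_simp; ring
    rw [e]
    refine (padicNorm.nonarchimedean (p := p)).trans (max_le ?_ ?_)
    · rw [padicNorm.mul]
      calc padicNorm p (u + t) * _ ≤ 1 * (p : ℚ) ^ (-(2 : ℤ)) := mul_le_mul hut ih (padicNorm.nonneg _) zero_le_one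
        _ = _ := one_mul _
    · rw [padicNorm.mul, padicNorm.div, padicNorm.mul, padicNorm_pow_eq, hu, one_pow, mul_one, div_one]
      calc padicNorm p (m : ℚ) * padicNorm p (t ^ 2) ≤ 1 * (p : ℚ) ^ (-(2 : ℤ)) :=
            mul_le_mul (by simpa using padicNorm.of_nat (p := p) m) ht2 (padicNorm.nonneg _) zero_le_one
        _ = _ := one_mul _

/-- **Integer powers: `(u + t)^e ≡ u^e (1 + e t/u) (mod p²)`** for a unit `u` and `‖t‖ ≤ p⁻¹`. -/
theorem padicNorm_zpow_add_sub_le {u t : ℚ} (hu : padicNorm p u = 1) (ht : padicNorm p t ≤ (p : ℚ) ^ (-(1 : ℤ))) (e : ℤ) :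
    padicNorm p ((u + t) ^ e - u ^ e * (1 + (e : ℚ) * t / u)) ≤ (p : ℚ) ^ (-(2 : ℤ)) := by
  have hu0 : u ≠ 0 := fun h => by rw [h, padicNorm.zero] at hu; exact zero_ne_one hu
  have hut1 : padicNorm p (u + t) = 1 := by
    have : u + t = u * (1 + t / u) := by field_simp
    rw [this, padicNorm.mul, hu, one_mul]
    exact padicNorm_one_add_eq_one (by rw [padicNorm.div, hu, div_one]; exact ht)
  rcases Int.eq_nat_or_neg e with ⟨m, rfl | rfl⟩
  · exact_mod_cast padicNorm_pow_add_sub_le hu ht m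
  · -- negative exponent: invert the congruence of the positive power
    set a : ℚ := (m : ℚ) * t / u with ha
    have haN : padicNorm p a ≤ (p : ℚ) ^ (-(1 : ℤ)) := by
      rw [ha, padicNorm.div, padicNorm.mul, hu, div_one]
      calc padicNorm p (m : ℚ) * padicNorm p t ≤ 1 * (p : ℚ) ^ (-(1 : ℤ)) :=
            mul_le_mul (by simpa using padicNorm.of_nat (p := p) m) ht (padicNorm.nonneg _) zero_le_one
        _ = _ := one_mul _
    have h1a : padicNorm p (1 + a) = 1 := padicNorm_one_add_eq_one haN
    have h1a0 : (1 + a) ≠ 0 := fun h => by rw [h, padicNorm.zero] at h1a; exact zero_ne_one h1a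
    have hV : padicNorm p ((u + t) ^ m) = 1 := by rw [padicNorm_pow_eq, hut1, one_pow]
    have hW : padicNorm p (u ^ m * (1 + a)) = 1 := by rw [padicNorm.mul, padicNorm_pow_eq, hu, one_pow, h1a, mul_one]
    have hVW : padicNorm p ((u + t) ^ m - u ^ m * (1 + a)) ≤ (p : ℚ) ^ (-(2 : ℤ)) := padicNorm_pow_add_sub_le hu ht m
    have hinv := padicNorm_inv_sub_inv_le_two hV hW hVW
    have hum : padicNorm p ((u ^ m)⁻¹) = 1 := by rw [padicNorm_inv', padicNorm_pow_eq, hu, one_pow, inv_one]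
    -- `(u^m(1+a))⁻¹ − u^{−m}(1 − a) = u^{−m}((1+a)⁻¹ − (1−a))`
    have e2 : (u ^ m * (1 + a))⁻¹ - (u ^ m)⁻¹ * (1 - a) = (u ^ m)⁻¹ * ((1 + a)⁻¹ - (1 - a)) := by
      rw [mul_inv]; ring
    have h2 : padicNorm p ((u ^ m * (1 + a))⁻¹ - (u ^ m)⁻¹ * (1 - a)) ≤ (p : ℚ) ^ (-(2 : ℤ)) := by
      rw [e2, padicNorm.mul, hum, one_mul]; exact padicNorm_inv_one_add_sub_le haN
    have e3 : (u + t) ^ (-(m : ℤ)) - u ^ (-(m : ℤ)) * (1 + ((-(m : ℤ) : ℤ) : ℚ) * t / u) =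
        (((u + t) ^ m)⁻¹ - (u ^ m * (1 + a))⁻¹) + ((u ^ m * (1 + a))⁻¹ - (u ^ m)⁻¹ * (1 - a)) := by
      rw [zpow_neg, zpow_neg, zpow_natCast, zpow_natCast, ha]; push_cast; ring
    rw [e3]
    exact (padicNorm.nonarchimedean (p := p)).trans (max_le hinv h2)

/-! ### Finite products: the logarithmic derivative modulo `p²` -/

/-- **`∏ (u_i + t)^{e_i} ≡ (∏ u_i^{e_i}) · (1 + t Σ e_i/u_i) (mod p²)`** for units `u_i` and `‖t‖ ≤ p⁻¹`. -/
theorem padicNorm_prod_zpow_add_sub_le {ι : Type*} (s : Finset ι) (u : ι → ℚ) (e : ι → ℤ) {t : ℚ}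
    (hu : ∀ i ∈ s, padicNorm p (u i) = 1) (ht : padicNorm p t ≤ (p : ℚ) ^ (-(1 : ℤ))) :
    padicNorm p (∏ i ∈ s, (u i + t) ^ e i - (∏ i ∈ s, u i ^ e i) * (1 + t * ∑ i ∈ s, (e i : ℚ) / u i)) ≤
      (p : ℚ) ^ (-(2 : ℤ)) := by
  classical
  have ht1 : padicNorm p t ≤ 1 := ht.trans (zpow_le_one_of_nonpos₀ one_le_p (by norm_num))
  have ht2 : padicNorm p (t ^ 2) ≤ (p : ℚ) ^ (-(2 : ℤ)) := by
    rw [padicNorm_pow_eq]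
    calc padicNorm p t ^ 2 ≤ ((p : ℚ) ^ (-(1 : ℤ))) ^ 2 := pow_le_pow_left₀ (padicNorm.nonneg _) ht 2
      _ = (p : ℚ) ^ (-(2 : ℤ)) := by rw [← zpow_natCast, ← zpow_mul]; norm_num
  induction s using Finset.induction_on with
  | empty =>
    rw [prod_empty, prod_empty, sum_empty, mul_zero, add_zero, mul_one, sub_self, padicNorm.zero]; exact zpow_p_nonneg _
  | insert a s ha ih =>
    have hua : padicNorm p (u a) = 1 := hu a (mem_insert_self a s)
    have hua0 : u a ≠ 0 := fun h => by rw [h, padicNorm.zero] at hua; exact zero_ne_one hua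
    have hus : ∀ i ∈ s, padicNorm p (u i) = 1 := fun i hi => hu i (mem_insert_of_mem hi)
    have ih' := ih hus
    -- norms of the pieces
    have hFa : padicNorm p ((u a + t) ^ e a) ≤ 1 := by
      have : padicNorm p (u a + t) = 1 := by
        have e1 : u a + t = u a * (1 + t / u a) := by field_simp
        rw [e1, padicNorm.mul, hua, one_mul]
        exact padicNorm_one_add_eq_one (by rw [padicNorm.div, hua, div_one]; exact ht)
      exact (padicNorm_zpow_unit this _).le
    have hPi : padicNorm p (∏ i ∈ s, u i ^ e i) ≤ 1 :=
      padicNorm_prod_le_one s _ fun i hi => (padicNorm_zpow_unit (hus i hi) _).le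
    have hSig : padicNorm p (∑ i ∈ s, (e i : ℚ) / u i) ≤ 1 := by
      refine padicNorm.sum_le' (fun i hi => ?_) zero_le_one
      rw [padicNorm.div, hus i hi, div_one]; exact padicNorm.of_int _
    have h1Sig : padicNorm p (1 + t * ∑ i ∈ s, (e i : ℚ) / u i) ≤ 1 := by
      refine (padicNorm.nonarchimedean (p := p)).trans (max_le (by rw [padicNorm.one]) ?_)
      rw [padicNorm.mul]
      calc padicNorm p t * _ ≤ 1 * 1 := mul_le_mul ht1 hSig (padicNorm.nonneg _) zero_le_one
        _ = 1 := one_mul 1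
    have hea : padicNorm p ((e a : ℚ) / u a) ≤ 1 := by rw [padicNorm.div, hua, div_one]; exact padicNorm.of_int _
    have hδa := padicNorm_zpow_add_sub_le hua ht (e a)
    rw [prod_insert ha, prod_insert ha, sum_insert ha]
    have eI : (u a + t) ^ e a * ∏ i ∈ s, (u i + t) ^ e i -
        (u a ^ e a * ∏ i ∈ s, u i ^ e i) * (1 + t * ((e a : ℚ) / u a + ∑ i ∈ s, (e i : ℚ) / u i)) =
        (u a + t) ^ e a * (∏ i ∈ s, (u i + t) ^ e i - (∏ i ∈ s, u i ^ e i) * (1 + t * ∑ i ∈ s, (e i : ℚ) / u i))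
        + ((u a + t) ^ e a - u a ^ e a * (1 + (e a : ℚ) * t / u a)) *
            ((∏ i ∈ s, u i ^ e i) * (1 + t * ∑ i ∈ s, (e i : ℚ) / u i))
        + u a ^ e a * (∏ i ∈ s, u i ^ e i) * ((e a : ℚ) / u a) * (∑ i ∈ s, (e i : ℚ) / u i) * t ^ 2 := by
      field_simp; ring
    rw [eI]
    refine (padicNorm.nonarchimedean (p := p)).trans
      (max_le ((padicNorm.nonarchimedean (p := p)).trans (max_le ?_ ?_)) ?_)
    · rw [padicNorm.mul]
      calc padicNorm p ((u a + t) ^ e a) * _ ≤ 1 * (p : ℚ) ^ (-(2 : ℤ)) :=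
            mul_le_mul hFa ih' (padicNorm.nonneg _) zero_le_one
        _ = _ := one_mul _
    · rw [padicNorm.mul, padicNorm.mul]
      calc _ * (padicNorm p (∏ i ∈ s, u i ^ e i) * _) ≤ (p : ℚ) ^ (-(2 : ℤ)) * (1 * 1) :=
            mul_le_mul hδa (mul_le_mul hPi h1Sig (padicNorm.nonneg _) zero_le_one)
              (mul_nonneg (padicNorm.nonneg _) (padicNorm.nonneg _)) (zpow_p_nonneg _)
        _ = _ := by ring
    · rw [padicNorm.mul, padicNorm.mul, padicNorm.mul, padicNorm.mul, padicNorm_zpow_unit hua, one_mul]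
      calc padicNorm p (∏ i ∈ s, u i ^ e i) * padicNorm p ((e a : ℚ) / u a) * padicNorm p (∑ i ∈ s, (e i : ℚ) / u i) *
            padicNorm p (t ^ 2) ≤ 1 * 1 * 1 * (p : ℚ) ^ (-(2 : ℤ)) :=
            mul_le_mul (mul_le_mul (mul_le_mul hPi hea (padicNorm.nonneg _) zero_le_one) hSig (padicNorm.nonneg _)
              (by positivity)) ht2 (padicNorm.nonneg _) (by positivity)
      _ = _ := by ring

/-! ### `φ_x`: integrality and class-constancy modulo `p` -/

/-- The centre term `b₀/2 − r` is a `p`-adic unit when the centre is not in the class of `r` (`p` odd). -/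
theorem padicNorm_centre_eq_one (b : ℕ → ℤ) (hp2 : p ≠ 2) {r : ℕ} (hr : ¬ CentreIn b p r) :
    padicNorm p (((b 0 : ℤ) : ℚ) / 2 - r) = 1 := by
  have htwo : padicNorm p (2 : ℚ) = 1 := by
    have := (padicNorm.nat_eq_one_iff (p := p) 2).2 (by
      intro h; exact hp2 ((Nat.prime_dvd_prime_iff_eq hp.out Nat.prime_two).1 h))
    exact_mod_cast this
  have e : (((b 0 : ℤ) : ℚ) / 2 - r) = (((b 0 - 2 * r : ℤ)) : ℚ) / 2 := by push_cast; ring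
  rw [e, padicNorm.div, htwo, div_one]
  refine (padicNorm.int_eq_one_iff _).2 fun hdvd => hr ?_
  unfold CentreIn
  have : (p : ℤ) ∣ -(b 0 - 2 * (r : ℤ)) := (dvd_neg).2 hdvd
  simpa [neg_sub, sub_eq_neg_add] using this

/-- **`φ_q` is `p`-integral.** -/
theorem padicNorm_phiHat_le_one (b : ℕ → ℤ) (hp2 : p ≠ 2) (q : ℕ) : padicNorm p (phiHat b p q) ≤ 1 := by
  unfold phiHat
  refine (padicNorm.nonarchimedean (p := p)).trans (max_le ?_ ?_)
  · refine padicNorm.sum_le' (fun s hs => ?_) zero_le_one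
    rw [padicNorm.div, padicNorm_sub_eq_one_of_mod_ne (mem_filter.1 hs).2, div_one]
    exact padicNorm.of_int _
  · split_ifs with h
    · rw [padicNorm.div, padicNorm.one, padicNorm_centre_eq_one b hp2 h.2, div_one]
    · simp

/-- **`φ` is class-constant modulo `p`**: `‖φ_q − φ_x‖_p ≤ p⁻¹` for `q` in the class of `x`. -/
theorem padicNorm_phiHat_sub_le (b : ℕ → ℤ) (hp2 : p ≠ 2) {x q : ℕ} (hq : q ∈ classSet b p x) :
    padicNorm p (phiHat b p q - phiHat b p x) ≤ (p : ℚ) ^ (-(1 : ℤ)) := by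
  have hqx : q % p = x % p := (mem_filter.1 hq).2
  have hqq' : padicNorm p ((x : ℚ) - q) ≤ (p : ℚ) ^ (-(1 : ℤ)) := by
    have hz : ((x : ℚ) - q) = (((x : ℤ) - q : ℤ) : ℚ) := by push_cast; ring
    rw [hz]
    have hdvd : ((p : ℕ) : ℤ) ^ 1 ∣ (x : ℤ) - q := by
      rw [pow_one]; exact Nat.modEq_iff_dvd.1 hqx
    simpa using padicNorm.dvd_iff_norm_le.1 hdvd
  have hcen : CentreIn b p q ↔ CentreIn b p x := centreIn_iff_of_mem hq
  set S := (range ((b 0).toNat + 1)).filter (fun s => s % p ≠ x % p) with hS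
  have hφq : phiHat b p q = (∑ s ∈ S, (netExp b s : ℚ) / ((s : ℚ) - q))
      + (if ¬ (2 : ℤ) ∣ b 0 ∧ ¬ CentreIn b p q then 1 / (((b 0 : ℤ) : ℚ) / 2 - q) else 0) := by
    rw [phiHat, hS, hqx]
  have hφx : phiHat b p x = (∑ s ∈ S, (netExp b s : ℚ) / ((s : ℚ) - x))
      + (if ¬ (2 : ℤ) ∣ b 0 ∧ ¬ CentreIn b p x then 1 / (((b 0 : ℤ) : ℚ) / 2 - x) else 0) := rfl
  have e : phiHat b p q - phiHat b p x =
      (∑ s ∈ S, ((netExp b s : ℚ) / ((s : ℚ) - q) - (netExp b s : ℚ) / ((s : ℚ) - x)))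
      + ((if ¬ (2 : ℤ) ∣ b 0 ∧ ¬ CentreIn b p q then 1 / (((b 0 : ℤ) : ℚ) / 2 - q) else 0)
          - (if ¬ (2 : ℤ) ∣ b 0 ∧ ¬ CentreIn b p x then 1 / (((b 0 : ℤ) : ℚ) / 2 - x) else 0)) := by
    rw [hφq, hφx, sum_sub_distrib]; ring
  rw [e]
  refine (padicNorm.nonarchimedean (p := p)).trans (max_le ?_ ?_)
  · refine padicNorm.sum_le' (fun s hs => ?_) (zpow_p_nonneg _)
    have hsx : s % p ≠ x % p := (mem_filter.1 hs).2
    have hsq : s % p ≠ q % p := by rwa [hqx]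
    have hu1 := padicNorm_sub_eq_one_of_mod_ne (p := p) hsq
    have hu2 := padicNorm_sub_eq_one_of_mod_ne (p := p) hsx
    have hn1 : ((s : ℚ) - q) ≠ 0 := fun h => by rw [h, padicNorm.zero] at hu1; exact zero_ne_one hu1
    have hn2 : ((s : ℚ) - x) ≠ 0 := fun h => by rw [h, padicNorm.zero] at hu2; exact zero_ne_one hu2
    have e2 : (netExp b s : ℚ) / ((s : ℚ) - q) - (netExp b s : ℚ) / ((s : ℚ) - x) =
        (netExp b s : ℚ) * (-((x : ℚ) - q)) / (((s : ℚ) - q) * ((s : ℚ) - x)) := by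
      field_simp; ring
    rw [e2, padicNorm.div, padicNorm.mul, padicNorm.mul, hu1, hu2, mul_one, div_one, padicNorm.neg]
    calc padicNorm p (netExp b s : ℚ) * padicNorm p ((x : ℚ) - q) ≤ 1 * (p : ℚ) ^ (-(1 : ℤ)) :=
          mul_le_mul (padicNorm.of_int _) hqq' (padicNorm.nonneg _) zero_le_one
      _ = _ := one_mul _
  · by_cases h : ¬ (2 : ℤ) ∣ b 0 ∧ ¬ CentreIn b p q
    · have h' : ¬ (2 : ℤ) ∣ b 0 ∧ ¬ CentreIn b p x := ⟨h.1, fun hc => h.2 (hcen.2 hc)⟩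
      rw [if_pos h, if_pos h']
      have hc1 := padicNorm_centre_eq_one b hp2 h.2
      have hc2 := padicNorm_centre_eq_one b hp2 h'.2
      have hn1 : (((b 0 : ℤ) : ℚ) / 2 - q) ≠ 0 := fun h0 => by rw [h0, padicNorm.zero] at hc1; exact zero_ne_one hc1
      have hn2 : (((b 0 : ℤ) : ℚ) / 2 - x) ≠ 0 := fun h0 => by rw [h0, padicNorm.zero] at hc2; exact zero_ne_one hc2
      have e3 : (1 * (((b 0 : ℤ) : ℚ) / 2 - x) - (((b 0 : ℤ) : ℚ) / 2 - q) * 1) = -((x : ℚ) - q) := by ring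
      rw [div_sub_div _ _ hn1 hn2, e3, padicNorm.div, padicNorm.mul, hc1, hc2, mul_one, div_one, padicNorm.neg]
      exact hqq'
    · have h' : ¬ (¬ (2 : ℤ) ∣ b 0 ∧ ¬ CentreIn b p x) := fun hc => h ⟨hc.1, fun hcc => hc.2 (hcen.1 hcc)⟩
      rw [if_neg h, if_neg h', sub_self, padicNorm.zero]; exact zpow_p_nonneg _

/-! ### `ĝ` to second order -/

/-- **`ĝ_q ≡ ĝ_x (1 − ℓ p φ_x) (mod p²)`** for `x < p` and `q = x + ℓp` in the class of `x` (`ℓ = q / p`), window `b₀ < p²`. -/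
theorem padicNorm_gHat_sub_second_le (b : ℕ → ℤ) (hp2 : p ≠ 2) {x q : ℕ} (hx : x < p) (hq : q ∈ classSet b p x) :
    padicNorm p (gHat b p q - gHat b p x * (1 - ((q / p : ℕ) : ℚ) * p * phiHat b p x)) ≤ (p : ℚ) ^ (-(2 : ℤ)) := by
  have hqx : q % p = x % p := (mem_filter.1 hq).2
  have htwo : padicNorm p (2 : ℚ) = 1 := by
    have := (padicNorm.nat_eq_one_iff (p := p) 2).2 (by
      intro h; exact hp2 ((Nat.prime_dvd_prime_iff_eq hp.out Nat.prime_two).1 h))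
    exact_mod_cast this
  -- `q = x + ℓ p`
  set ℓ := q / p with hℓ
  have hqdec : (q : ℚ) = x + (ℓ : ℚ) * p := by
    have h1 := Nat.div_add_mod q p
    rw [hqx, Nat.mod_eq_of_lt hx] at h1
    have : (q : ℚ) = ((p * ℓ + x : ℕ) : ℚ) := by rw [hℓ, h1]
    rw [this]; push_cast; ring
  set t : ℚ := -((ℓ : ℚ) * p) with htdef
  have ht : padicNorm p t ≤ (p : ℚ) ^ (-(1 : ℤ)) := by
    rw [htdef, padicNorm.neg, padicNorm.mul, padicNorm_p]
    calc padicNorm p (ℓ : ℚ) * (p : ℚ) ^ (-(1 : ℤ)) ≤ 1 * (p : ℚ) ^ (-(1 : ℤ)) :=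
          mul_le_mul_of_nonneg_right (by simpa using padicNorm.of_nat (p := p) ℓ) (zpow_p_nonneg _)
      _ = _ := one_mul _
  have ht1 : padicNorm p t ≤ 1 := ht.trans (zpow_le_one_of_nonpos₀ one_le_p (by norm_num))
  have ht2 : padicNorm p (t ^ 2) ≤ (p : ℚ) ^ (-(2 : ℤ)) := by
    rw [padicNorm_pow_eq]
    calc padicNorm p t ^ 2 ≤ ((p : ℚ) ^ (-(1 : ℤ))) ^ 2 := pow_le_pow_left₀ (padicNorm.nonneg _) ht 2
      _ = (p : ℚ) ^ (-(2 : ℤ)) := by rw [← zpow_natCast, ← zpow_mul]; norm_num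
  -- the foreign set and the foreign products
  set S := (range ((b 0).toNat + 1)).filter (fun s => s % p ≠ x % p) with hS
  have hunit : ∀ s ∈ S, padicNorm p ((s : ℚ) - x) = 1 := fun s hs => padicNorm_sub_eq_one_of_mod_ne (mem_filter.1 hs).2
  have hsq : ∀ s ∈ S, ((s : ℚ) - q) = ((s : ℚ) - x) + t := by intro s _; rw [hqdec, htdef]; ring
  set A' := ∏ s ∈ S, ((s : ℚ) - q) ^ netExp b s with hA'
  set A := ∏ s ∈ S, ((s : ℚ) - x) ^ netExp b s with hA
  set Q := ∑ s ∈ S, (netExp b s : ℚ) / ((s : ℚ) - x) with hQ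
  have hAQ : padicNorm p (A' - A * (1 + t * Q)) ≤ (p : ℚ) ^ (-(2 : ℤ)) := by
    have h := padicNorm_prod_zpow_add_sub_le S (fun s => ((s : ℚ) - x)) (fun s => netExp b s) hunit ht
    rw [hA', prod_congr rfl fun s hs => by rw [hsq s hs]]
    exact h
  have hA1 : padicNorm p A ≤ 1 := padicNorm_prod_le_one S _ fun s hs => (padicNorm_zpow_unit (hunit s hs) _).le
  have hQ1 : padicNorm p Q ≤ 1 := by
    refine padicNorm.sum_le' (fun s hs => ?_) zero_le_one
    rw [padicNorm.div, hunit s hs, div_one]; exact padicNorm.of_int _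
  -- the two `ĝ`'s and `φ_x` over `S`
  have hcen : CentreIn b p q ↔ CentreIn b p x := centreIn_iff_of_mem hq
  have hgq : gHat b p q = 2 * A' * (if ¬ (2 : ℤ) ∣ b 0 ∧ ¬ CentreIn b p q then ((b 0 : ℤ) : ℚ) / 2 - q else 1) := by
    rw [gHat, hA', hS, hqx]
  have hgx : gHat b p x = 2 * A * (if ¬ (2 : ℤ) ∣ b 0 ∧ ¬ CentreIn b p x then ((b 0 : ℤ) : ℚ) / 2 - x else 1) := rfl
  have hφx : phiHat b p x = Q + (if ¬ (2 : ℤ) ∣ b 0 ∧ ¬ CentreIn b p x then 1 / (((b 0 : ℤ) : ℚ) / 2 - x) else 0) := rfl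
  have hℓt : ((ℓ : ℚ) : ℚ) * p = -t := by rw [htdef, neg_neg]
  rw [hgq, hgx, hφx, hℓt]
  by_cases h : ¬ (2 : ℤ) ∣ b 0 ∧ ¬ CentreIn b p q
  · -- odd `b₀`, centre outside the class: `c' = c + t`
    have h' : ¬ (2 : ℤ) ∣ b 0 ∧ ¬ CentreIn b p x := ⟨h.1, fun hc => h.2 (hcen.2 hc)⟩
    rw [if_pos h, if_pos h', if_pos h']
    set c : ℚ := ((b 0 : ℤ) : ℚ) / 2 - x with hc
    have hc1 : padicNorm p c = 1 := padicNorm_centre_eq_one b hp2 h'.2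
    have hc0 : c ≠ 0 := fun h0 => by rw [h0, padicNorm.zero] at hc1; exact zero_ne_one hc1
    have hc' : ((b 0 : ℤ) : ℚ) / 2 - q = c + t := by rw [hc, hqdec, htdef]; ring
    have hcq1 : padicNorm p (c + t) ≤ 1 := (padicNorm.nonarchimedean (p := p)).trans (max_le hc1.le ht1)
    rw [hc']
    have eI : 2 * A' * (c + t) - 2 * A * c * (1 - -t * (Q + 1 / c)) =
        2 * (c + t) * (A' - A * (1 + t * Q)) + 2 * A * Q * t ^ 2 := by
      field_simp; ring
    rw [eI]
    refine (padicNorm.nonarchimedean (p := p)).trans (max_le ?_ ?_)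
    · rw [padicNorm.mul, padicNorm.mul, htwo, one_mul]
      calc padicNorm p (c + t) * _ ≤ 1 * (p : ℚ) ^ (-(2 : ℤ)) := mul_le_mul hcq1 hAQ (padicNorm.nonneg _) zero_le_one
        _ = _ := one_mul _
    · rw [padicNorm.mul, padicNorm.mul, padicNorm.mul, htwo, one_mul]
      calc padicNorm p A * padicNorm p Q * padicNorm p (t ^ 2) ≤ 1 * 1 * (p : ℚ) ^ (-(2 : ℤ)) :=
            mul_le_mul (mul_le_mul hA1 hQ1 (padicNorm.nonneg _) zero_le_one) ht2 (padicNorm.nonneg _) (by positivity)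
        _ = _ := by ring
  · have h' : ¬ (¬ (2 : ℤ) ∣ b 0 ∧ ¬ CentreIn b p x) := fun hc => h ⟨hc.1, fun hcc => hc.2 (hcen.1 hcc)⟩
    rw [if_neg h, if_neg h', if_neg h']
    have eI : 2 * A' * 1 - 2 * A * 1 * (1 - -t * (Q + 0)) = 2 * (A' - A * (1 + t * Q)) := by ring
    rw [eI, padicNorm.mul, htwo, one_mul]
    exact hAQ

end Summit.KontsevichZagierPeriods.Zeta5Search.SecondOrder

end
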